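import Summits.HodgeConjecture.HodgeConjecture.Theorems.HCCMUnconditionalH21OfLevelStructure
import Literature.NumberTheory.ComplexMultiplication.MainTheoremCMLevelStructure
import Literature.NumberTheory.ComplexMultiplication.CMBalancedDivisorFiniteExtensionOfPolarised
import Literature.NumberTheory.ComplexMultiplication.CMDefinedOverQbarHolds
import Literature.AlgebraicGeometry.Motives.AbelianVarietyGoodReductionHomConjFrob
import HarnessLib

/-!
# `HCCMUnconditional.H21` from the PRINTED FACTS of the main-theorem line (h21 head of record after S7a)

Topic: summit `HodgeConjecture`, sub-problem `HodgeConjecture`, route `HCCMUnconditional`, crux `H21` (item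
stmt-HodgeConjecture-24834).  PROVER FILE (cell hodgecm-mathlib, D-0151 release track, ladder HODGECM-MATHLIB rung 0; seat B-p10
by director g2 BATCH 62, second B-p06; `--supports stmt-HodgeConjecture-24834 --as helper`): sorry-free, axioms ⊆ trio, ONE THEOREM.

The binder `h21` ([Shimura1998, Thm. 21.4] / Casselman) of `hc_cm_of_printed_citations_…` is now read off the PRINTED residuals of the
fan-B line `b2_main_theorem_cm` ALONE.  A-p01's `H21_of_levelStructure` (p610723) gives `H21 ⇐ {S7a levelStructure, S5b
exists_balancedDivisor_finiteExtension, VI-NOS ×3}`; the S7a assembly `levelStructure_of_facts` (B-p15's harness of record, core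
`exists_isLevelUniformization_of_levelField` p610823 + B-p09's field selection, closer `MainTheoremCMLevelStructure`) gives
`levelStructure ⇐ {II-2, F-S2 shimuraTaniyamaPair, FactRH′, FactS5c}` with II-2 `shimura1998_prop26_definedOverNumberField_holds`
PROVED (A-p14 p608173); and A-p06's `exists_balancedDivisor_finiteExtension_of_balancedPolarisedStructure` gives
`S5b ⇐ S5b″ exists_balancedPolarisedStructure_numberField`.  Composing BY NAME:

* `H21_of_printedFacts (hS2) (hRH) (hS5c) (hS5b″) (r₁ r₂ r₃) : …HCCMUnconditional.H21` — **h21 ⇐ {F-S2 `shimuraTaniyamaPair`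
  ([Shimura1998] §13.1 Thm. 1 (i) / Shimura–Taniyama), FactRH′ (reduction data with Frobenius companions, produced-data form of
  [SerreTate1968] §1 + [Shimura1998] §11.1 Prop. 12/14), FactS5c (Tate-compatible families along `conjFrob`), S5b″
  `exists_balancedPolarisedStructure_numberField` ([Shimura1998] §6.2 Thm. 4 (3) + §12.4 Prop. 26 + §4.1 Prop. 10), and the three
  reduction-theory records VI-NOS (`nonempty_goodReductionAt`, `nonempty_tateSpecialisation`, `hasGoodReductionAt_of_isUnramifiedAt`)}** —
  seven hypotheses, each a named printed statement; nothing else.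

HC_CM is proved only modulo the 7 printed citations until rung 0 closes; this head discharges no binder by itself — it is the term the
headline's `h21` slot is fed with once the seven have `_holds`.

## References
* [Shimura1998] G. Shimura, *Abelian Varieties with Complex Multiplication and Modular Functions*, PUP (1998): §18.6 Thm. 18.6 (proof
  pp. 164–169); §21.4 Thm. 21.4; §13.1 Thm. 1; §6.2 Thm. 4 (3); §12.4 Prop. 26; §4.1 Prop. 10; Thm. 19.11.
* [SerreTate1968] J.-P. Serre, J. Tate, *Good reduction of abelian varieties*, Ann. of Math. 88 (1968), §1 Thm. 1, §7 Thm. 10–12.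
-/

set_option autoImplicit false

open IsDedekindDomain
open NumberField hiding ideleGroup
open scoped NumberField

namespace Summit.HodgeConjecture.CorCM.Hyp21

open Literature.AlgebraicGeometry.Motives Literature.AlgebraicGeometry.Motives.AbelianVariety
open Literature.NumberTheory.GaloisRepresentations
open Literature.NumberTheory.ComplexMultiplication
open CategoryTheory
open scoped ComplexConjugate nonZeroDivisors

/-- **`HCCMUnconditional.H21` ⇐ the seven PRINTED residuals of the main-theorem line** — F-S2 `shimuraTaniyamaPair`, FactRH′
(reduction data with Frobenius companions), FactS5c (Tate-compatible families along `conjFrob`), S5b″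
`exists_balancedPolarisedStructure_numberField`, and the three reduction-theory records — by
`H21_of_levelStructure (levelStructure_of_facts shimura1998_prop26_definedOverNumberField_holds hS2 hRH hS5c)
(exists_balancedDivisor_finiteExtension_of_balancedPolarisedStructure hS5b″) r₁ r₂ r₃` (row II-2 consumed BY NAME, A-p14 p608173).
HC_CM is proved only modulo the 7 printed citations until rung 0 closes.
[cite: Shimura1998, §21.4 Thm. 21.4; §18.6 Thm. 18.6 (proof pp. 164–169); §13.1 Thm. 1 (i); §6.2 Thm. 4 (3)]
[cite: SerreTate1968, §1 Thm. 1; §7 Thm. 10–12] -/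
theorem H21_of_printedFacts
    (hS2 : shimuraTaniyamaPair)
    (hRH : ∀ {k : Type} [Field k] [NumberField k] {ι : Type} [Finite ι] (A : ι → AbelianVariety k),
      ∃ S : Set (HeightOneSpectrum (𝓞 k)), S.Finite ∧ ∀ v ∉ S, ∃ R : ∀ i, (A i).GoodReductionAt v,
        (∀ i j, Nonempty (GoodReductionAt.HomReduction (R i) (R j))) ∧
        ∀ {F₀ : Type} [Field F₀] [NumberField F₀] [Algebra F₀ k] (a : ι) (γ : k ≃ₐ[F₀] k)
          (hγ : IsArithFrobAt (𝓞 F₀) γ v.asIdeal) (p n : ℕ) [ExpChar v.asIdeal.ResidueField p]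
          (hq : Nat.card (𝓞 F₀ ⧸ v.asIdeal.under (𝓞 F₀)) = p ^ n),
          (∀ i, Nonempty (GoodReductionAt.HomReduction (R i) ((R a).conjFrob γ hγ p n hq))) ∧
          (∀ i, Nonempty (GoodReductionAt.HomReduction ((R a).conjFrob γ hγ p n hq) (R i))))
    (hS5c : ∀ {F₀ k : Type} [Field F₀] [NumberField F₀] [Field k] [NumberField k] [Algebra F₀ k]
      {v : HeightOneSpectrum (𝓞 k)} {ι : Type} {A : ι → AbelianVariety k}
      (R : ∀ i, (A i).GoodReductionAt v) (H : ∀ i j, GoodReductionAt.HomReduction (R i) (R j)) (a : ι)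
      (γ : k ≃ₐ[F₀] k) (hγ : IsArithFrobAt (𝓞 F₀) γ v.asIdeal) (p n : ℕ) [ExpChar v.asIdeal.ResidueField p]
      (hq : Nat.card (𝓞 F₀ ⧸ v.asIdeal.under (𝓞 F₀)) = p ^ n)
      (Hγ : ∀ i, GoodReductionAt.HomReduction (R i) ((R a).conjFrob γ hγ p n hq))
      (Hγ' : ∀ i, GoodReductionAt.HomReduction ((R a).conjFrob γ hγ p n hq) (R i)) (ℓ : ℕ) [Fact ℓ.Prime],
      GoodReductionAt.HomReduction.exists_isTateCompatible_family_conjFrob R H a γ hγ p n hq Hγ Hγ' ℓ)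
    (hS5b'' : exists_balancedPolarisedStructure_numberField)
    (r₁ : ∀ (k : Type) [Field k] [NumberField k] (A₀ : AbelianVariety k) (v : HeightOneSpectrum (𝓞 k)),
      AbelianVariety.nonempty_goodReductionAt A₀ v)
    (r₂ : ∀ (k : Type) [Field k] [NumberField k] (A₀ : AbelianVariety k) (v : HeightOneSpectrum (𝓞 k))
      (R : A₀.GoodReductionAt v) (ℓ : ℕ) [Fact ℓ.Prime], R.nonempty_tateSpecialisation ℓ)
    (r₃ : ∀ (k : Type) [Field k] [NumberField k] (A₀ : AbelianVariety k) (v : HeightOneSpectrum (𝓞 k)),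
      AbelianVariety.hasGoodReductionAt_of_isUnramifiedAt A₀ v) :
    Summit.HodgeConjecture.HodgeConjecture.Theses.HCCMUnconditional.H21 :=
  H21_of_levelStructure (levelStructure_of_facts shimura1998_prop26_definedOverNumberField_holds hS2 hRH hS5c)
    (exists_balancedDivisor_finiteExtension_of_balancedPolarisedStructure hS5b'') r₁ r₂ r₃

/-- **`HCCMUnconditional.H21` ⇐ SIX printed residuals** — F-S2 `shimuraTaniyamaPair`, FactS5c, S5b″
`exists_balancedPolarisedStructure_numberField` and the three reduction-theory records: `H21_of_printedFacts` with its reduction-data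
binder FactRH′ DISCHARGED by the tree theorem `AbelianVariety.exists_finite_forall_exists_goodReductionAt_homReduction_conjFrob`
(cofinite good reduction of a finite family with the Frobenius companions; B-p19, over B-p07's abelian-scheme models and B-p12's
`conjFrob`).  HC_CM is proved only modulo the 7 printed citations until rung 0 closes.
[cite: Shimura1998, §21.4 Thm. 21.4; §18.6 Thm. 18.6 (proof pp. 164–169); §13.1 Thm. 1 (i); §6.2 Thm. 4 (3)]
[cite: SerreTate1968, §1 Thm. 1; §7 Thm. 10–12] [cite: BombieriGubler2006, 10.3.9 (p. 334)] -/
theorem H21_of_sixPrintedFacts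
    (hS2 : shimuraTaniyamaPair)
    (hS5c : ∀ {F₀ k : Type} [Field F₀] [NumberField F₀] [Field k] [NumberField k] [Algebra F₀ k]
      {v : HeightOneSpectrum (𝓞 k)} {ι : Type} {A : ι → AbelianVariety k}
      (R : ∀ i, (A i).GoodReductionAt v) (H : ∀ i j, GoodReductionAt.HomReduction (R i) (R j)) (a : ι)
      (γ : k ≃ₐ[F₀] k) (hγ : IsArithFrobAt (𝓞 F₀) γ v.asIdeal) (p n : ℕ) [ExpChar v.asIdeal.ResidueField p]
      (hq : Nat.card (𝓞 F₀ ⧸ v.asIdeal.under (𝓞 F₀)) = p ^ n)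
      (Hγ : ∀ i, GoodReductionAt.HomReduction (R i) ((R a).conjFrob γ hγ p n hq))
      (Hγ' : ∀ i, GoodReductionAt.HomReduction ((R a).conjFrob γ hγ p n hq) (R i)) (ℓ : ℕ) [Fact ℓ.Prime],
      GoodReductionAt.HomReduction.exists_isTateCompatible_family_conjFrob R H a γ hγ p n hq Hγ Hγ' ℓ)
    (hS5b'' : exists_balancedPolarisedStructure_numberField)
    (r₁ : ∀ (k : Type) [Field k] [NumberField k] (A₀ : AbelianVariety k) (v : HeightOneSpectrum (𝓞 k)),
      AbelianVariety.nonempty_goodReductionAt A₀ v)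
    (r₂ : ∀ (k : Type) [Field k] [NumberField k] (A₀ : AbelianVariety k) (v : HeightOneSpectrum (𝓞 k))
      (R : A₀.GoodReductionAt v) (ℓ : ℕ) [Fact ℓ.Prime], R.nonempty_tateSpecialisation ℓ)
    (r₃ : ∀ (k : Type) [Field k] [NumberField k] (A₀ : AbelianVariety k) (v : HeightOneSpectrum (𝓞 k)),
      AbelianVariety.hasGoodReductionAt_of_isUnramifiedAt A₀ v) :
    Summit.HodgeConjecture.HodgeConjecture.Theses.HCCMUnconditional.H21 :=
  H21_of_printedFacts hS2 (fun A => AbelianVariety.exists_finite_forall_exists_goodReductionAt_homReduction_conjFrob A)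
    hS5c hS5b'' r₁ r₂ r₃

end Summit.HodgeConjecture.CorCM.Hyp21
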